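/-
  Summits/AtomisticToContinuum/Crystallization/Theorems/OverbindingBudgetAffineFarEngineLabels.lean

  residual stmt-AtomisticToContinuum-31280 · slot Z `FarAggregatePricing 12 (1/25) (1/2000) (1/(2·10⁷))` · leaf LAB₁′
  `ShelteredShellLabelling' (1/25) (1/2000)` (leaf list v14′; engine of record rows 899/908/922): E4 part 4 — from the frame to the
  stacking: BBI♯ + FILL give the based isometric copy containing (and filled by) the inner coordinates; CORE♯ recharts `c`; the
  CENTRE FIT from `IsChart` clause 3 transported through `Recharts` (error `Cε₁·nn`, `R`-independent) and the INTERIOR FITS from the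
  sites' own affine frames made LINEAR by PCR₁ `barlowShell_relabelling_rigidity` (error `≤ 2ε₁·nn`).  decomp-a2c lens-4, generation 58.
  Imports E4 part 3 `…FarEngineFrame`.  0 sorry · 0 axiom · no instance · no notation · no option.
-/
import Summits.AtomisticToContinuum.Crystallization.Theorems.OverbindingBudgetAffineFarEngineFrame

/-! # E4 part 4 — base, core call, centre and interior fits (PROVED)

* `EngineFrame.based`: BBI♯ at `ρ = ρ_R/2` (shell hypothesis of part 3) and the lattice filling of part 2 ⇒ a Hägg word `s`, a
  linear isometry `g`, a base point `p₀ ∈ 𝓛(s)` with INCLUSION `x k = g(p − p₀)` for inner `k` with `‖x k‖ ≤ r := (ρ_R/2 − ρ₀)/2` and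
  FILLING `g(p − p₀) = x k` (some inner `k`) for `‖p − p₀‖ ≤ r − 1`.
* `EngineFrame.core`: CORE♯ applied with `B₀ := B`, `η := τ` (its `hsite`/`hpt` from inclusion/filling on the `9nn`-window, which has
  coordinate radius `≤ 10.3 ≤ r − 1`) ⇒ `c'`, `R₀`, `Recharts (1/25) c c'`, `𝓛(c'.s) = R₀⁻¹(𝓛(s) − p₀)`, defect bound.
* `EngineFrame.centre_fit`: for an inner `k'` whose label `p` (`g(R₀ p) = x k'`) is a stacking point of norm `≤ 1`,
  `‖y k' − y i − c'.a₀ c'.B p‖ ≤ Cε₁·nn` — `IsChart` clause 3 at `R p ∈ 𝓛(c.s)` (Recharts' core-ball equivalence) produces a site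
  `Cε₁nn`-near `y i + Φ_c′(p)`, which is `y k'` by SEPARATION (the defect bound puts `y k'` within `0.015·nn` of the same point).
* `EngineFrame.interior_fit`: at an inner `k` with affine frame `(Q, A, P, f)` (from `goodSet`), contact vectors `e` whose steps
  `x k + W e` are inner coordinates: the step sites are first-shell partners `f(G e)` with `‖G e‖ = 1` (a `√2`-vector would be too
  far), `G` is `0.08`-close to the linear map `(a₀/nn_k)·Q⁻¹ B W` on the contact shell, so PCR₁ makes `G = U` linear isometric, and
  `L_k := nn_k · A ∘ U` fits with error `ε₁ nn_k ≤ 2ε₁ nn`.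
-/

namespace Summit.AtomisticToContinuum.Crystallization.Theorems.OverbindingBudgetAffineFarSmoothSplit

open Literature.MathematicalPhysics.StatisticalMechanics
open Literature.Geometry.DiscreteGeometry
open Summit.AtomisticToContinuum.Crystallization.Theorems.OverbindingBudgetAffineLadder
open Summit.AtomisticToContinuum.Crystallization.Theorems.OverbindingBudgetAffineLocalisation
open scoped Classical

namespace EngineFrame

variable {N : ℕ} {y : Fin N → EuclideanSpace ℝ (Fin 3)} {i : Fin N} {ρR a₀ τ : ℝ}
  {B : EuclideanSpace ℝ (Fin 3) →ₗ[ℝ] EuclideanSpace ℝ (Fin 3)} {x : Fin N → EuclideanSpace ℝ (Fin 3)}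

/-! ## §1  Base: BBI♯ + filling -/

/-- **BASE (PROVED)**: BBI♯ (with constant `ρ₀`, `ρ_R ≥ 50 + 2ρ₀`) and the lattice filling give the based isometric stacking copy
containing the inner coordinates of norm `≤ r = (ρ_R/2 − ρ₀)/2` and filled by them up to `‖p − p₀‖ ≤ r − 1`. [this file] -/
theorem based (hF : EngineFrame y i ρR a₀ τ B x) {ρ₀ : ℝ} (hρ₀ : 0 ≤ ρ₀) (hρ₀R : 50 + 2 * ρ₀ ≤ ρR)
    (hBBI : ∀ (Λ : Set (EuclideanSpace ℝ (Fin 3))) (ρ : ℝ), ρ₀ ≤ ρ → (0 : EuclideanSpace ℝ (Fin 3)) ∈ Λ →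
      (∀ x ∈ Λ, ‖x‖ ≤ ρ →
        ∃ (A : EuclideanSpace ℝ (Fin 3) →ₗᵢ[ℝ] EuclideanSpace ℝ (Fin 3)) (P : Finset (EuclideanSpace ℝ (Fin 3))),
          (P = fccTwoShellPattern ∨ P = hcpTwoShellPattern) ∧ (∀ v ∈ P, x + A v ∈ Λ) ∧
          ∀ x' ∈ Λ, x' ≠ x → dist x' x < hales_h0 → ∃ v ∈ P, x' = x + A v) →
      ∃ (s : ℤ → ℤ) (g : EuclideanSpace ℝ (Fin 3) ≃ₗᵢ[ℝ] EuclideanSpace ℝ (Fin 3)) (p₀ : EuclideanSpace ℝ (Fin 3)),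
        IsHaggSeq s ∧ p₀ ∈ barlowStacking 1 (Real.sqrt (2 / 3)) s ∧
        ∀ x ∈ Λ, ‖x‖ ≤ (ρ - ρ₀) / 2 → ∃ p ∈ barlowStacking 1 (Real.sqrt (2 / 3)) s, x = g (p - p₀)) :
    ∃ (s : ℤ → ℤ) (g : EuclideanSpace ℝ (Fin 3) ≃ₗᵢ[ℝ] EuclideanSpace ℝ (Fin 3)) (p₀ : EuclideanSpace ℝ (Fin 3)),
      IsHaggSeq s ∧ p₀ ∈ barlowStacking 1 (Real.sqrt (2 / 3)) s ∧
      (∀ k, dist (y k) (y i) ≤ (ρR - 3) * nearestDist y i → ‖x k‖ ≤ (ρR / 2 - ρ₀) / 2 →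
        ∃ p ∈ barlowStacking 1 (Real.sqrt (2 / 3)) s, x k = g (p - p₀)) ∧
      ∀ p ∈ barlowStacking 1 (Real.sqrt (2 / 3)) s, ‖p - p₀‖ ≤ (ρR / 2 - ρ₀) / 2 - 1 →
        ∃ k, dist (y k) (y i) ≤ (ρR - 3) * nearestDist y i ∧ x k = g (p - p₀) := by
  have h0 : (0 : EuclideanSpace ℝ (Fin 3)) ∈ x '' {k | dist (y k) (y i) ≤ (ρR - 3) * nearestDist y i} :=
    ⟨i, by
      show dist (y i) (y i) ≤ (ρR - 3) * nearestDist y i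
      rw [dist_self]; exact mul_nonneg (by linarith [hF.ρR_ge]) (nearestDist_nonneg y i), hF.x_centre⟩
  obtain ⟨s, g, p₀, hs, hp₀, hincl⟩ := hBBI _ (ρR / 2) (by linarith [hF.ρR_ge]) h0 hF.shell
  refine ⟨s, g, p₀, hs, hp₀, fun k hk hxk => hincl (x k) ⟨k, hk, rfl⟩ hxk, fun p hp hpr => ?_⟩
  have hshell' : ∀ x₀ ∈ x '' {k | dist (y k) (y i) ≤ (ρR - 3) * nearestDist y i}, ‖x₀‖ ≤ ρR / 2 →
      ∃ (A : EuclideanSpace ℝ (Fin 3) →ₗᵢ[ℝ] EuclideanSpace ℝ (Fin 3)) (P : Finset (EuclideanSpace ℝ (Fin 3))),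
        (P = fccTwoShellPattern ∨ P = hcpTwoShellPattern) ∧
        ∀ v ∈ P, x₀ + A v ∈ x '' {k | dist (y k) (y i) ≤ (ρR - 3) * nearestDist y i} := by
    intro x₀ hx₀ hn
    obtain ⟨A, P, hP, hmem, -⟩ := hF.shell x₀ hx₀ hn
    exact ⟨A, P, hP, hmem⟩
  obtain ⟨k, hk, hkx⟩ := barlow_fill hshell' hs g hp₀ hincl (by linarith [hF.ρR_ge, hρ₀]) h0 p hp hpr
  exact ⟨k, hk, hkx⟩

/-! ## §2  The CORE♯ call -/

/-- **CORE CALL (PROVED)**: CORE♯ with `B₀ := B`, `η := τ`; `hsite`/`hpt` from inclusion/filling (`r ≥ 25/2`). [this file] -/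
theorem core (hF : EngineFrame y i ρR a₀ τ B x) {s : ℤ → ℤ} (hs : IsHaggSeq s)
    (g : EuclideanSpace ℝ (Fin 3) ≃ₗᵢ[ℝ] EuclideanSpace ℝ (Fin 3)) {p₀ : EuclideanSpace ℝ (Fin 3)}
    (hp₀ : p₀ ∈ barlowStacking 1 (Real.sqrt (2 / 3)) s) {r : ℝ} (hr : 25 / 2 ≤ r)
    (hincl : ∀ k, dist (y k) (y i) ≤ (ρR - 3) * nearestDist y i → ‖x k‖ ≤ r →
      ∃ p ∈ barlowStacking 1 (Real.sqrt (2 / 3)) s, x k = g (p - p₀))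
    (hfill : ∀ p ∈ barlowStacking 1 (Real.sqrt (2 / 3)) s, ‖p - p₀‖ ≤ r - 1 →
      ∃ k, dist (y k) (y i) ≤ (ρR - 3) * nearestDist y i ∧ x k = g (p - p₀))
    (hCORE : CoreRechartSharp (1 / 25)) {C ε₁ : ℝ} (hC : 0 ≤ C) (hε₁ : 0 < ε₁) (hCε : C * ε₁ ≤ 1 / 100)
    {c : Chart} (hchart : IsChart C ε₁ y i c) (hadm : ChartAdmissible (1 / 25) c) :
    ∃ (c' : Chart) (R₀ : EuclideanSpace ℝ (Fin 3) ≃ₗᵢ[ℝ] EuclideanSpace ℝ (Fin 3)), Recharts (1 / 25) c c' ∧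
      (∀ p : EuclideanSpace ℝ (Fin 3),
        p ∈ barlowStacking 1 (Real.sqrt (2 / 3)) c'.s ↔ R₀ p + p₀ ∈ barlowStacking 1 (Real.sqrt (2 / 3)) s) ∧
      ∀ v : EuclideanSpace ℝ (Fin 3),
        ‖c'.a₀ • c'.B v - a₀ • B (g (R₀ v))‖ ≤ 4 / 17 * ((C * ε₁ + τ) * nearestDist y i) * ‖v‖ := by
  have hnn := hF.nn_pos
  refine hCORE C τ ε₁ hC hF.τ_nonneg hε₁ hCε hF.τ_le N y i c hchart hadm a₀ B s g p₀ hF.a₀_pos hF.B_near hs hp₀ ?_ ?_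
  · intro k hk9
    have hkJ : dist (y k) (y i) ≤ (ρR - 3) * nearestDist y i :=
      hk9.trans (mul_le_mul_of_nonneg_right (by linarith [hF.ρR_ge]) hnn.le)
    have hxk : ‖x k‖ ≤ r := by
      have h1 := hF.norm_le k
      have h2 : nearestDist y i * (7 / 8 * ‖x k‖) ≤ nearestDist y i * (901 / 100) := by linarith
      have h3 := le_of_mul_le_mul_left h2 hnn
      linarith
    obtain ⟨p, hp, hxp⟩ := hincl k hkJ hxk
    refine ⟨p, hp, ?_⟩
    rw [dist_eq_norm, sub_add_eq_sub_sub, ← hxp]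
    exact hF.close k
  · intro q hq hq9
    have hqr : ‖q - p₀‖ ≤ r - 1 := by
      have h1 := hF.le_smul_norm (g (q - p₀))
      rw [LinearIsometryEquiv.norm_map, norm_smul, Real.norm_eq_abs, abs_of_pos hF.a₀_pos] at h1
      have h2 : nearestDist y i * (7 / 8 * ‖q - p₀‖) ≤ nearestDist y i * 9 := by linarith
      have h3 := le_of_mul_le_mul_left h2 hnn
      linarith
    obtain ⟨k, -, hxk⟩ := hfill q hq hqr
    refine ⟨k, ?_⟩
    rw [dist_eq_norm, sub_add_eq_sub_sub, ← hxk]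
    exact hF.close k

/-! ## §3  The centre fit -/

/-- **CENTRE FIT (PROVED)**: `‖y k' − y i − Φ_c′(p)‖ ≤ Cε₁·nn` for an inner `k'` labelled by a stacking point `p` of norm `≤ 1`. [this file] -/
theorem centre_fit (hF : EngineFrame y i ρR a₀ τ B x) {C ε₁ : ℝ} (hCε : C * ε₁ ≤ 1 / 100)
    {c c' : Chart} (hchart : IsChart C ε₁ y i c) (hrc : Recharts (1 / 25) c c')
    (g R₀ : EuclideanSpace ℝ (Fin 3) ≃ₗᵢ[ℝ] EuclideanSpace ℝ (Fin 3))
    (hD : ∀ v : EuclideanSpace ℝ (Fin 3),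
      ‖c'.a₀ • c'.B v - a₀ • B (g (R₀ v))‖ ≤ 4 / 17 * ((C * ε₁ + τ) * nearestDist y i) * ‖v‖)
    {k' : Fin N} (hk'J : dist (y k') (y i) ≤ (ρR - 3) * nearestDist y i) {p : EuclideanSpace ℝ (Fin 3)}
    (hp : p ∈ barlowStacking 1 (Real.sqrt (2 / 3)) c'.s) (hp1 : ‖p‖ ≤ 1) (hxp : g (R₀ p) = x k') :
    ‖y k' - y i - c'.a₀ • c'.B p‖ ≤ C * ε₁ * nearestDist y i := by
  have hnn := hF.nn_pos
  obtain ⟨hadm', ha, -, R, hBR, hball⟩ := hrc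
  have hca : 0 < c.a₀ := by rw [← ha]; exact hadm'.2.1
  have hΦ : c'.a₀ • c'.B p = c.a₀ • c.B (R p) := by rw [ha, hBR]
  -- the defect at `p`
  have hct : (C * ε₁ + τ) * nearestDist y i ≤ 1 / 50 * nearestDist y i :=
    mul_le_mul_of_nonneg_right (by linarith [hF.τ_le]) hnn.le
  have hDp : ‖c'.a₀ • c'.B p - a₀ • B (g (R₀ p))‖ ≤ 1 / 200 * nearestDist y i := by
    refine (hD p).trans ?_
    have h1 : 4 / 17 * ((C * ε₁ + τ) * nearestDist y i) * ‖p‖ ≤ 4 / 17 * (1 / 50 * nearestDist y i) * 1 :=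
      mul_le_mul (mul_le_mul_of_nonneg_left hct (by norm_num)) hp1 (norm_nonneg _)
        (mul_nonneg (by norm_num) (mul_nonneg (by norm_num) hnn.le))
    linarith
  -- the norm of the physical point
  have hΦn : ‖c'.a₀ • c'.B p‖ ≤ 114 / 100 * nearestDist y i := by
    have h1 : ‖c'.a₀ • c'.B p‖ ≤ ‖a₀ • B (g (R₀ p))‖ + ‖c'.a₀ • c'.B p - a₀ • B (g (R₀ p))‖ := norm_le_insert' _ _
    have h2 := hF.smul_norm_le (g (R₀ p))
    rw [LinearIsometryEquiv.norm_map, LinearIsometryEquiv.norm_map] at h2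
    have h3 : nearestDist y i * ‖p‖ ≤ nearestDist y i * 1 := mul_le_mul_of_nonneg_left hp1 hnn.le
    linarith
  have hcnn : 99 / 100 * nearestDist y i ≤ c.nn := by
    have h1 := (abs_le.1 hchart.1).1
    have h2 : C * ε₁ * nearestDist y i ≤ 1 / 100 * nearestDist y i := mul_le_mul_of_nonneg_right hCε hnn.le
    linarith
  have hnormΦ : c.a₀ * ‖c.B (R p)‖ = ‖c'.a₀ • c'.B p‖ := by
    rw [hΦ, norm_smul, Real.norm_eq_abs, abs_of_pos hca]
  have hlt : c.a₀ * ‖c.B (R p)‖ < 44 / 5 * c.nn := by rw [hnormΦ]; linarith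
  have hRp : R p ∈ barlowStacking 1 (Real.sqrt (2 / 3)) c.s := (hball p hlt).2 hp
  obtain ⟨k'', hk''⟩ := hchart.2.2 (R p) hRp (by rw [hnormΦ]; linarith)
  rw [← hΦ] at hk''
  -- `y k'` is close to the same point
  have hk'close : dist (y k') (y i + c'.a₀ • c'.B p) ≤ 3 / 200 * nearestDist y i := by
    rw [dist_eq_norm, sub_add_eq_sub_sub]
    have e : y k' - y i - c'.a₀ • c'.B p = (y k' - y i - a₀ • B (x k')) + (a₀ • B (g (R₀ p)) - c'.a₀ • c'.B p) := by
      rw [hxp]; abel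
    rw [e]
    refine (norm_add_le _ _).trans ?_
    rw [norm_sub_rev (a₀ • B (g (R₀ p)))]
    have h1 := hF.close k'
    have h2 : τ * nearestDist y i ≤ 1 / 100 * nearestDist y i := mul_le_mul_of_nonneg_right hF.τ_le hnn.le
    linarith
  by_cases hkk : k'' = k'
  · subst hkk
    rw [dist_eq_norm, sub_add_eq_sub_sub] at hk''
    exact hk''
  · exfalso
    have hsep := hF.sep hk'J hkk
    have h3 : dist (y k'') (y k') ≤ dist (y k'') (y i + c'.a₀ • c'.B p) + dist (y k') (y i + c'.a₀ • c'.B p) :=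
      dist_triangle_right _ _ _
    have h4 : C * ε₁ * nearestDist y i ≤ 1 / 100 * nearestDist y i := mul_le_mul_of_nonneg_right hCε hnn.le
    linarith

/-! ## §4  The interior fits -/

/-- **First-shell partners are unit pattern vectors (PROVED)**: in an affine frame `(Q, A, P, f)` at an inner `k` (tolerances `ε₁ ≤ 1/100`,
`θ = 1/25`), a partner `f v = y k''` at distance `≤ 1.145·nn` from `y k` has `‖v‖ = 1` (since `nn_k ≥ 0.85·nn`). [this file] -/
theorem norm_eq_one_of_partner (hF : EngineFrame y i ρR a₀ τ B x) {ε₁ : ℝ} (hε₁' : ε₁ ≤ 1 / 100) {k k'' : Fin N}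
    (hkJ : dist (y k) (y i) ≤ (ρR - 3) * nearestDist y i) (hd : dist (y k'') (y k) ≤ 229 / 200 * nearestDist y i)
    {Q : EuclideanSpace ℝ (Fin 3) →ₗᵢ[ℝ] EuclideanSpace ℝ (Fin 3)} {A : EuclideanSpace ℝ (Fin 3) →ₗ[ℝ] EuclideanSpace ℝ (Fin 3)}
    {P : Finset (EuclideanSpace ℝ (Fin 3))} (hP : P = fccTwoShellPattern ∨ P = hcpTwoShellPattern)
    {v : EuclideanSpace ℝ (Fin 3)} (hv : v ∈ P) (hAQ : ‖A v - Q v‖ ≤ 1 / 25)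
    (hfit : dist (y k'') (y k + nearestDist y k • A v) ≤ ε₁ * nearestDist y k) : ‖v‖ = 1 := by
  have hnn := hF.nn_pos
  have hnnk := hF.nn_ge hkJ
  have hn : ‖v‖ = 1 ∨ ‖v‖ = Real.sqrt 2 := by
    rcases hP with rfl | rfl
    exacts [norm_of_mem_fccTwoShellPattern hv, norm_of_mem_hcpTwoShellPattern hv]
  rcases hn with h | h
  · exact h
  exfalso
  have hnnk0 : 0 ≤ nearestDist y k := nearestDist_nonneg y k
  have hA : Real.sqrt 2 - 1 / 25 ≤ ‖A v‖ := by
    have h1 : ‖Q v‖ ≤ ‖A v‖ + ‖Q v - A v‖ := norm_le_insert' _ _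
    rw [Q.norm_map, h, norm_sub_rev] at h1
    linarith
  have hlow : nearestDist y k * ‖A v‖ - ε₁ * nearestDist y k ≤ dist (y k'') (y k) := by
    have h1 : dist (y k + nearestDist y k • A v) (y k) = nearestDist y k * ‖A v‖ := by
      rw [dist_eq_norm, add_sub_cancel_left, norm_smul_of_nonneg hnnk0]
    have h2 := dist_triangle (y k + nearestDist y k • A v) (y k'') (y k)
    rw [h1, dist_comm] at h2
    linarith
  have h3 : nearestDist y k * (Real.sqrt 2 - 1 / 25) ≤ nearestDist y k * ‖A v‖ := mul_le_mul_of_nonneg_left hA hnnk0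
  have h1414 : (1414 / 1000 : ℝ) < Real.sqrt 2 := by
    rw [show (1414 / 1000 : ℝ) = Real.sqrt ((1414 / 1000) ^ 2) by rw [Real.sqrt_sq (by norm_num)]]
    exact Real.sqrt_lt_sqrt (by norm_num) (by norm_num)
  have h4 : nearestDist y k * (1414 / 1000) ≤ nearestDist y k * Real.sqrt 2 :=
    mul_le_mul_of_nonneg_left h1414.le hnnk0
  have h5 : ε₁ * nearestDist y k ≤ 1 / 100 * nearestDist y k := mul_le_mul_of_nonneg_right hε₁' hnnk0
  nlinarith

/-- **INTERIOR FIT (PROVED)**: at an inner site `k` with affine frame, if every contact step `x k + W e` (`e` in a contact shell) is an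
inner coordinate, a LINEAR map `L_k` fits all these steps with error `≤ 2ε₁·nn`. [this file] -/
theorem interior_fit (hF : EngineFrame y i ρR a₀ τ B x) {ε₁ : ℝ} (hε₁ : 0 < ε₁) (hε₁' : ε₁ ≤ 1 / 100) {k : Fin N}
    (hkJ : dist (y k) (y i) ≤ (ρR - 3) * nearestDist y i) (hfr : AffFramed ε₁ (1 / 25) (1 / 450) y k)
    (W : EuclideanSpace ℝ (Fin 3) ≃ₗᵢ[ℝ] EuclideanSpace ℝ (Fin 3)) {σ σ' : ℝ} (hσ : σ = 1 ∨ σ = -1) (hσ' : σ' = 1 ∨ σ' = -1)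
    (HL : ∀ e ∈ barlowShell σ σ', ∃ k'' : Fin N, dist (y k'') (y i) ≤ (ρR - 3) * nearestDist y i ∧ x k'' = x k + W e) :
    ∃ L : EuclideanSpace ℝ (Fin 3) →ₗ[ℝ] EuclideanSpace ℝ (Fin 3),
      ∀ e ∈ barlowShell σ σ', ∀ k' : Fin N, x k' = x k + W e → ‖y k' - y k - L e‖ ≤ 2 * ε₁ * nearestDist y i := by
  have hnn := hF.nn_pos
  have hnnk := hF.nn_ge hkJ
  have hnnk_pos : 0 < nearestDist y k := by linarith
  haveI : Nonempty (Fin N) := ⟨k⟩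
  choose! lab hlabJ hlabx using HL
  -- the labelled contact neighbours
  have hnb : ∀ e ∈ barlowShell σ σ', lab e ≠ k ∧ dist (y (lab e)) (y k) ≤ 229 / 200 * nearestDist y i ∧
      ‖y (lab e) - y k - a₀ • B (W e)‖ ≤ 1 / 50 * nearestDist y i := by
    intro e he
    have he1 : ‖e‖ = 1 := norm_eq_one_of_mem_barlowShell hσ hσ' he
    have hx : x (lab e) - x k = W e := by rw [hlabx e he, add_sub_cancel_left]
    have h3 := hF.norm_sub_sub_le k (lab e)
    rw [hx] at h3
    refine ⟨fun h => ?_, ?_, h3⟩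
    · rw [h, sub_self] at hx
      have : ‖e‖ = 0 := by rw [← W.norm_map, ← hx, norm_zero]
      rw [he1] at this
      exact one_ne_zero this
    · have h4 := hF.smul_norm_le (W e)
      rw [W.norm_map, he1, mul_one] at h4
      have h5 : ‖y (lab e) - y k‖ ≤ ‖y (lab e) - y k - a₀ • B (W e)‖ + ‖a₀ • B (W e)‖ := by
        have := norm_add_le (y (lab e) - y k - a₀ • B (W e)) (a₀ • B (W e))
        rwa [sub_add_cancel] at this
      rw [dist_eq_norm]
      linarith
  -- the frame at `k` and the first-shell partners `G e`
  obtain ⟨Q, A, P, f, hP, hAQ, hf, -, hfexh⟩ := hfr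
  have hG : ∀ e ∈ barlowShell σ σ', ∃ v ∈ P, f v = y (lab e) := fun e he =>
    hfexh (lab e) (hnb e he).1 ((hnb e he).2.1.trans (by linarith))
  choose! G hGP hGf using hG
  have hG1 : ∀ e ∈ barlowShell σ σ', ‖G e‖ = 1 := by
    intro e he
    have h1 := (hf (G e) (hGP e he)).2
    rw [hGf e he] at h1
    exact hF.norm_eq_one_of_partner hε₁' hkJ (hnb e he).2.1 hP (hGP e he) (hAQ _ (hGP e he)) h1
  obtain ⟨σ₂, τ₂, hσ₂, hτ₂, V, hV⟩ := exists_kissing_eq_image_barlowShell hP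
  have hmaps : Set.MapsTo G (barlowShell σ σ') (V '' barlowShell σ₂ τ₂) :=
    fun e he => (hV (G e)).1 ⟨hGP e he, hG1 e he⟩
  -- the comparison linear map `T = (a₀/nn_k) · Q⁻¹ B W`
  set Qe := Q.toLinearIsometryEquiv rfl with hQe_def
  have hQe : ∀ v, Qe v = Q v := fun v => rfl
  set T : EuclideanSpace ℝ (Fin 3) →ₗ[ℝ] EuclideanSpace ℝ (Fin 3) :=
    (a₀ / nearestDist y k) • (Qe.symm.toLinearEquiv.toLinearMap ∘ₗ B ∘ₗ W.toLinearEquiv.toLinearMap) with hT_def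
  have hTe : ∀ e, T e = (a₀ / nearestDist y k) • Qe.symm (B (W e)) := fun e => rfl
  have hclose : ∀ e ∈ barlowShell σ σ', ‖G e - T e‖ ≤ 2 / 25 := by
    intro e he
    have h1 : ‖G e - T e‖ = ‖Q (G e) - (a₀ / nearestDist y k) • B (W e)‖ := by
      rw [← Qe.norm_map, map_sub, hQe, hTe, LinearIsometryEquiv.map_smul, LinearIsometryEquiv.apply_symm_apply]
    have h2 : nearestDist y k * ‖Q (G e) - (a₀ / nearestDist y k) • B (W e)‖ =
        ‖nearestDist y k • Q (G e) - a₀ • B (W e)‖ := by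
      rw [← norm_smul_of_nonneg hnnk_pos.le, smul_sub, smul_smul, mul_div_cancel₀ _ hnnk_pos.ne']
    have h3 : ‖nearestDist y k • Q (G e) - a₀ • B (W e)‖ ≤
        1 / 25 * nearestDist y k + ε₁ * nearestDist y k + 1 / 50 * nearestDist y i := by
      have e1 : nearestDist y k • Q (G e) - a₀ • B (W e) = nearestDist y k • (Q (G e) - A (G e)) +
          ((y k + nearestDist y k • A (G e)) - y (lab e)) + (y (lab e) - y k - a₀ • B (W e)) := by
        rw [smul_sub]; abel
      rw [e1]
      refine (norm_add₃_le).trans ?_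
      have t1 : ‖nearestDist y k • (Q (G e) - A (G e))‖ ≤ 1 / 25 * nearestDist y k := by
        rw [norm_smul_of_nonneg hnnk_pos.le, norm_sub_rev, mul_comm]
        exact mul_le_mul_of_nonneg_right (hAQ _ (hGP e he)) hnnk_pos.le
      have t2 : ‖(y k + nearestDist y k • A (G e)) - y (lab e)‖ ≤ ε₁ * nearestDist y k := by
        rw [← dist_eq_norm, dist_comm]
        have := (hf (G e) (hGP e he)).2
        rwa [hGf e he] at this
      linarith [(hnb e he).2.2]
    rw [h1]
    have h4 : nearestDist y k * ‖Q (G e) - (a₀ / nearestDist y k) • B (W e)‖ ≤ nearestDist y k * (2 / 25) := by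
      rw [h2]
      have h5 : ε₁ * nearestDist y k ≤ 1 / 100 * nearestDist y k := mul_le_mul_of_nonneg_right hε₁' hnnk_pos.le
      linarith
    exact le_of_mul_le_mul_left h4 hnnk_pos
  obtain ⟨U, hU⟩ := barlowShell_relabelling_rigidity hσ hσ' hσ₂ hτ₂ V T G hmaps hclose (by norm_num)
  refine ⟨nearestDist y k • (A ∘ₗ U.toLinearMap), fun e he k' hk' => ?_⟩
  have hk'e : k' = lab e := hF.inj (hlabJ e he) (hk'.trans (hlabx e he).symm)
  rw [hk'e]
  have hL : (nearestDist y k • (A ∘ₗ U.toLinearMap)) e = nearestDist y k • A (G e) := by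
    rw [LinearMap.smul_apply, LinearMap.comp_apply, hU e he]
    rfl
  rw [hL, ← hGf e he]
  have h := (hf (G e) (hGP e he)).2
  rw [dist_eq_norm, ← sub_sub] at h
  have hnnk_le : nearestDist y k ≤ 229 / 200 * nearestDist y i := by
    have := nearestDist_le_dist y (hnb e he).1
    rw [dist_comm] at this
    exact this.trans (hnb e he).2.1
  have h6 : ε₁ * nearestDist y k ≤ ε₁ * (229 / 200 * nearestDist y i) := mul_le_mul_of_nonneg_left hnnk_le hε₁.le
  nlinarith

end EngineFrame

end Summit.AtomisticToContinuum.Crystallization.Theorems.OverbindingBudgetAffineFarSmoothSplit
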